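import Summits.NavierStokesRegularity.FluidComputer.GateBudgetRungClock
import HarnessLib

/-!
# GateBudget part 90 — the pulse debit: the clock identity on the pulse half (§260–§261)

Cell `pub-fluidc`, blueprint seat bp1 (gen 37 close-out: SPEC-INPUT-bp1 §BP(7a)/(7c), item (c′),
first file); namespace `Summit.NavierStokesRegularity.FluidComputer.GateBudget`, headline member
`RotorKnob.rotorCircuit K K¹⁰ ε ρ` from `delayInit` (5.6), `K ≥ 16`, lattice window
`200ε/K²⁰ ≤ ρ² ≤ 2ε/K¹⁰`, `ε² ≤ 1/(6K²⁰)`, `ε = kK¹⁰ρ²` (`σ = ρ²e^{-K¹⁰}`, `μ = ε⁻¹K¹⁰`);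
modes `0 = a` (carrier), `1 = b` (clock), `2 = c` (trigger), `3 = d` (transfer), `4 = ã`
(output), `R² = b² + c²`. Imports part 84 (`GateBudgetRungClock`) only; independent of parts
87–89. HONEST FRAMING: a low prior, high value-of-information experiment on Tao's machine
paradigm; NOT a claim that NS blows up. Nothing whatsoever is proved about the Navier–Stokes
equations. [cite: Tao2016AveragedNS, §5.5 Theorem 5.3, (5.5), (5.6), (b-eq), (c-eq), (ta-eq),
(energy-con), (est)]

WHY (SPEC-INPUT-bp1 §BP(7a)). Parts 84–89 charge the clock `242 log K/K¹⁰` per rung: part 61's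
radius Lipschitz law over part 80's pulse length. Four exact identities say more: `(b² + c²)' =
2a²(εb + σc)` (part 1 `bc_energy`), `(log c - μB)' = σa²/c` for a clock action `B' = b` (part 56
§169–§170), `ã' = Kd²`, and the sphere `a² = 1 - b² - c² - d² - ã²`. With `W = 1 - ã(r)²` the
functional `R² - 2εW·B + (3ε²/K)ã + 3ε²κt`, `κ = 2ã(r)g + g² + 9ε²/4` (`g` the output gain), is
NON-DECREASING on the pulse half `[r, T']` (`V = W - a² ≥ 0`, `2·abs (bV) ≤ 3εV`), and part 56's
upper law bounds the action spent: `μ(B(T') - B(r)) ≥ log c(T') - log c(r) - 484/K¹⁰`. So the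
pulse DEBITS `θ²` by `2W·Λ/K¹⁰`, `Λ = log((ρ²/K⁹)/c(T')) ∈ [log(K/2), 361.5 log K]`, up to
`(3 + 10⁻⁶)g/K + 10⁻⁶/K¹⁰` — a statement the cold half can CREDIT back (§BP(7c)).

WHAT IS PROVED. §260 `pulse_debit_pointwise`, `action_lower`, `knob_pulse_debit_functional` (the
monotone functional on any window with `R² ≤ 9ε²/4`, `c ≥ 0`; knob family), `pulse_debit_numerics`.
§261 `knob_pulse_debit`: part 84 §246's pulse half VERBATIM (its seventeen facts re-exported, so
the exit `T'` is shared) AND `log(K/2) ≤ Λ ≤ (723/2) log K` AND THE DEBIT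
`θ² ≤ θ₁² + 2(1 - ã(r)²)Λ/K¹⁰ + (3 + 10⁻⁶)(ã(T') - ã(r))/K + 10⁻⁶/K¹⁰`. Honest limits: one-sided;
the cold credit, the rung balance and the ladder are NOT in this file; constants generous; nothing
about Navier–Stokes.
-/

noncomputable section

namespace Summit.NavierStokesRegularity.FluidComputer.GateBudget

open Real Set
open Literature.Analysis.FluidPDE.Tao2016AveragedNS

variable {K ε ρ : ℝ} {X : ℝ → Fin 5 → ℝ} {C : ℝ → ℝ}

/-! ## §260 The pulse-debit functional -/

/-- §260 POINTWISE: on the sphere, with `abs b ≤ 3ε/2`, `b² + c² ≤ 9ε²/4`, `c, σ ≥ 0`, `K > 0`,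
`0 ≤ e₀ ≤ ã ≤ e₀ + g`, `W = 1 - e₀²`, `κ = 2e₀g + g² + 9ε²/4`:
`2εWb - (3ε²/K·(Kd²) + 3ε²κ) ≤ 2εa²b + 2σa²c`. [derived: this file §260] -/
theorem pulse_debit_pointwise {σ a b c d e e₀ g W κ : ℝ} (hε : 0 ≤ ε) (hσ : 0 ≤ σ) (hK : 0 < K)
    (hc : 0 ≤ c) (hsph : a ^ 2 + b ^ 2 + c ^ 2 + d ^ 2 + e ^ 2 = 1) (hb : |b| ≤ 3 / 2 * ε)
    (hR : b ^ 2 + c ^ 2 ≤ 9 / 4 * ε ^ 2) (he0 : 0 ≤ e₀) (hee : e₀ ≤ e) (heg : e ≤ e₀ + g)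
    (hW : W = 1 - e₀ ^ 2) (hκ : κ = 2 * e₀ * g + g ^ 2 + 9 / 4 * ε ^ 2) :
    2 * ε * W * b - (3 * ε ^ 2 / K * (K * d ^ 2) + 3 * ε ^ 2 * κ * 1)
      ≤ 2 * ε * a ^ 2 * b + 2 * σ * a ^ 2 * c := by
  have hK0 : K ≠ 0 := hK.ne'
  have hKd : 3 * ε ^ 2 / K * (K * d ^ 2) = 3 * ε ^ 2 * d ^ 2 := by field_simp
  rw [hKd, mul_one]
  obtain ⟨V, hV⟩ : ∃ V : ℝ, V = (e ^ 2 - e₀ ^ 2) + d ^ 2 + (b ^ 2 + c ^ 2) := ⟨_, rfl⟩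
  have ha2 : a ^ 2 = W - V := by rw [hV, hW]; linarith
  have hV0 : 0 ≤ V := by
    rw [hV]; nlinarith [mul_le_mul hee hee he0 (he0.trans hee)]
  have hVle : V ≤ κ - 9 / 4 * ε ^ 2 + (b ^ 2 + c ^ 2) + d ^ 2 := by
    rw [hV, hκ]
    nlinarith [mul_le_mul heg heg (he0.trans hee) (by linarith : 0 ≤ e₀ + g)]
  have h32b : 0 ≤ 3 * ε - 2 * b := by linarith [(abs_le.1 hb).2]
  have h1 : 0 ≤ ε * V * (3 * ε - 2 * b) := mul_nonneg (mul_nonneg hε hV0) h32b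
  have h2 : 0 ≤ 2 * σ * a ^ 2 * c := by positivity
  have h3 : 0 ≤ 3 * ε ^ 2 * (κ + d ^ 2 - V) := mul_nonneg (by positivity) (by linarith)
  rw [ha2] at h2 ⊢
  linarith

/-- §260 ACTION LOWER BOUND: a clock action `B` (`B' = b`) with `b ≥ -β` on `[s, u]` has
`-β(t - s) ≤ B(t) - B(s)` for `t ∈ [s, u]`. [derived: this file §260] -/
theorem action_lower {B : ℝ → ℝ} (hB : ∀ t, HasDerivAt B (X t 1) t) {s u β : ℝ}
    (hb : ∀ t ∈ Icc s u, -β ≤ X t 1) {t : ℝ} (ht : t ∈ Icc s u) :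
    -(β * (t - s)) ≤ B t - B s := by
  have hmono := Thm53.monotoneOn_sub_of_le_deriv (f := B) (f' := fun r => X r 1)
    (φ := fun _ => -β * 1) (Φ := fun r => -β * r) (convex_Icc s u) (fun r _ => hB r)
    (fun r _ => (hasDerivAt_id' r).const_mul (-β)) (fun r hr => by
      show -β * 1 ≤ X r 1
      linarith [hb r hr])
  have h := hmono (left_mem_Icc.2 (ht.1.trans ht.2)) ht ht.1
  dsimp only at h
  linarith

/-- §260 **THE PULSE-DEBIT FUNCTIONAL.** Knob family `rotorCircuit K M ε ρ` from (5.6) (any `M`;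
`ε ≥ 0`, `K > 0`), any clock action `B` (`B' = b`), any window `0 ≤ s ≤ u` on which
`b² + c² ≤ 9ε²/4` and `c ≥ 0`: with `W = 1 - ã(s)²`, `g = ã(u) - ã(s)`,
`κ = 2ã(s)g + g² + 9ε²/4`: `R²(u) ≥ R²(s) + 2εW(B(u) - B(s)) - (3ε²/K)g - 3ε²κ(u - s)` —
`R² - 2εWB + (3ε²/K)ã + 3ε²κt` is non-decreasing (§260 pointwise, `bc_energy`, `ã' = Kd²`, the
sphere, `ã` monotone). [derived: this file §260] -/
theorem knob_pulse_debit_functional {M : ℝ}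
    (hX : ∀ t, HasDerivAt X (RotorKnob.rotorCircuit K M ε ρ (X t)) t) (h0 : X 0 = delayInit)
    (hε : 0 ≤ ε) (hK : 0 < K) {B : ℝ → ℝ} (hB : ∀ t, HasDerivAt B (X t 1) t)
    {s u : ℝ} (hs : 0 ≤ s) (hsu : s ≤ u)
    (hR : ∀ t ∈ Icc s u, X t 1 ^ 2 + X t 2 ^ 2 ≤ 9 / 4 * ε ^ 2)
    (hc : ∀ t ∈ Icc s u, 0 ≤ X t 2) :
    X s 1 ^ 2 + X s 2 ^ 2 + 2 * ε * (1 - X s 4 ^ 2) * (B u - B s)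
        - 3 * ε ^ 2 / K * (X u 4 - X s 4)
        - 3 * ε ^ 2 * (2 * X s 4 * (X u 4 - X s 4) + (X u 4 - X s 4) ^ 2 + 9 / 4 * ε ^ 2)
          * (u - s) ≤ X u 1 ^ 2 + X u 2 ^ 2 := by
  have hmon : Monotone fun t => X t 4 := RotorKnob.rotorCircuit_output_monotone hK.le hX
  have he0 : 0 ≤ X s 4 := RotorKnob.e_nonneg hX h0 hK.le hs
  obtain ⟨g, hg⟩ : ∃ g : ℝ, g = X u 4 - X s 4 := ⟨_, rfl⟩
  obtain ⟨κ, hκ⟩ : ∃ κ : ℝ, κ = 2 * X s 4 * g + g ^ 2 + 9 / 4 * ε ^ 2 := ⟨_, rfl⟩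
  obtain ⟨W, hW⟩ : ∃ W : ℝ, W = 1 - X s 4 ^ 2 := ⟨_, rfl⟩
  have hXf := hX
  rw [RotorKnob.rotorCircuit_eq_fiveGate] at hXf
  have hσ : 0 ≤ ρ ^ 2 * exp (-M) := by positivity
  have hΦ : ∀ t, HasDerivAt
      (fun r => 2 * ε * W * B r - (3 * ε ^ 2 / K * X r 4 + 3 * ε ^ 2 * κ * r))
      (2 * ε * W * X t 1 - (3 * ε ^ 2 / K * (K * X t 3 ^ 2) + 3 * ε ^ 2 * κ * 1)) t := fun t =>
    ((hB t).const_mul (2 * ε * W)).sub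
      (((RotorKnob.hasDerivAt_e hX t).const_mul (3 * ε ^ 2 / K)).add
        ((hasDerivAt_id' t).const_mul (3 * ε ^ 2 * κ)))
  have hmono := Thm53.monotoneOn_sub_of_le_deriv (f := fun r => X r 1 ^ 2 + X r 2 ^ 2)
    (f' := fun r => 2 * ε * X r 0 ^ 2 * X r 1 + 2 * (ρ ^ 2 * exp (-M)) * X r 0 ^ 2 * X r 2)
    (φ := fun t => 2 * ε * W * X t 1 - (3 * ε ^ 2 / K * (K * X t 3 ^ 2) + 3 * ε ^ 2 * κ * 1))
    (Φ := fun r => 2 * ε * W * B r - (3 * ε ^ 2 / K * X r 4 + 3 * ε ^ 2 * κ * r))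
    (convex_Icc s u) (fun r _ => bc_energy (hXf r)) (fun r _ => hΦ r) (fun r hr => by
      have hbabs : |X r 1| ≤ 3 / 2 * ε := by
        have h1 : X r 1 ^ 2 ≤ (3 / 2 * ε) ^ 2 := by nlinarith [hR r hr, sq_nonneg (X r 2)]
        have h2 := sq_le_sq.1 h1
        rwa [abs_of_nonneg (by positivity : (0 : ℝ) ≤ 3 / 2 * ε)] at h2
      exact pulse_debit_pointwise hε hσ hK (hc r hr) (RotorKnob.traj_sum_sq_eq_one hX h0 r)
        hbabs (hR r hr) he0 (hmon hr.1) (by rw [hg]; linarith [hmon hr.2]) hW hκ)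
  have h := hmono (left_mem_Icc.2 hsu) (right_mem_Icc.2 hsu) hsu
  dsimp only at h
  subst hκ hg hW
  linarith

/-- §260 PULSE-DEBIT NUMERICS: `K ≥ 16`, `ε² ≤ 1/(6K²⁰)` ⇒ `9·(241 log K/K¹⁰) ≤ 1/(10⁶K)`,
`968/K²⁰ + (27/4)ε²(241 log K/K¹⁰) ≤ 1/(10⁶K¹⁰)`, `(3/2)(241 log K) ≤ K¹⁰/2` and
`1/(1 + K¹⁰/2) ≤ 2/K¹⁰` (the seed's Duhamel weight). [derived: this file §260] -/
theorem pulse_debit_numerics (hK : 16 ≤ K) (hεK : ε ^ 2 ≤ 1 / (6 * K ^ 20)) :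
    9 * (241 * log K / K ^ 10) ≤ 1 / (10 ^ 6 * K) ∧
      968 / K ^ 20 + 27 / 4 * ε ^ 2 * (241 * log K / K ^ 10) ≤ 1 / (10 ^ 6 * K ^ 10) ∧
      3 / 2 * (241 * log K) ≤ K ^ 10 / 2 ∧ 1 / (1 + K ^ 10 / 2) ≤ 2 / K ^ 10 := by
  have hK0 : (0 : ℝ) < K := by linarith
  have hK1 : (1 : ℝ) ≤ K := by linarith
  have hlog : log K ≤ K - 1 := Real.log_le_sub_one_of_pos hK0
  have hlog0 : 0 ≤ log K := Real.log_nonneg hK1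
  have h8 : (16 : ℝ) ^ 8 ≤ K ^ 8 := pow_le_pow_left₀ (by norm_num) hK 8
  have h9 : (16 : ℝ) ^ 9 ≤ K ^ 9 := pow_le_pow_left₀ (by norm_num) hK 9
  have h10 : (16 : ℝ) ^ 10 ≤ K ^ 10 := pow_le_pow_left₀ (by norm_num) hK 10
  have h11 : (16 : ℝ) ≤ K ^ 11 := hK.trans (le_self_pow₀ hK1 (by norm_num))
  norm_num at h8 h9 h10
  have hK10 : (0 : ℝ) < K ^ 10 := by positivity
  have hK20 : (0 : ℝ) < K ^ 20 := by positivity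
  have hL0 : 0 ≤ 241 * log K / K ^ 10 := div_nonneg (by positivity) hK10.le
  have hi : 9 * (241 * log K / K ^ 10) ≤ 1 / (10 ^ 6 * K) := by
    have e : 9 * (241 * log K / K ^ 10) = 2169 * log K / K ^ 10 := by ring
    rw [e, div_le_div_iff₀ hK10 (by positivity)]
    have h1 : K * log K ≤ K * K := by nlinarith [mul_le_mul_of_nonneg_left hlog hK0.le]
    have h2 : (2169 * 10 ^ 6 : ℝ) * (K * K) ≤ K ^ 8 * (K * K) :=
      mul_le_mul_of_nonneg_right (by linarith) (by positivity)
    nlinarith [h1, h2]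
  refine ⟨hi, ?_, ?_, ?_⟩
  · have h1 : 968 / K ^ 20 ≤ 1 / (2 * 10 ^ 6 * K ^ 10) := by
      rw [div_le_div_iff₀ hK20 (by positivity)]
      nlinarith [mul_le_mul_of_nonneg_right h10 hK10.le, hK10.le]
    have hA : 241 * log K / K ^ 10 ≤ 1 / (10 ^ 6 * K) := by linarith
    have h2 : 27 / 4 * ε ^ 2 * (241 * log K / K ^ 10) ≤ 1 / (2 * 10 ^ 6 * K ^ 10) :=
      calc 27 / 4 * ε ^ 2 * (241 * log K / K ^ 10)
          ≤ 27 / 4 * (1 / (6 * K ^ 20)) * (1 / (10 ^ 6 * K)) :=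
            mul_le_mul (mul_le_mul_of_nonneg_left hεK (by norm_num)) hA hL0 (by positivity)
        _ = 9 / 8 / (10 ^ 6 * (K ^ 10 * K ^ 11)) := by field_simp; ring
        _ ≤ 1 / (2 * 10 ^ 6 * K ^ 10) := by
            rw [div_le_div_iff₀ (by positivity) (by positivity)]
            nlinarith [mul_le_mul_of_nonneg_left h11 hK10.le]
    have e3 : (1 : ℝ) / (2 * 10 ^ 6 * K ^ 10) + 1 / (2 * 10 ^ 6 * K ^ 10)
        = 1 / (10 ^ 6 * K ^ 10) := by ring
    linarith [h1, h2, e3]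
  · nlinarith [mul_le_mul_of_nonneg_right h9 hK0.le, hlog]
  · rw [div_le_div_iff₀ (by positivity) hK10]
    nlinarith

/-! ## §261 The pulse debit -/

/-- §261 **THE PULSE DEBIT** (headline member from `delayInit` with a trigger primitive `C`; part
84 §246's hypotheses verbatim). THEN part 84 §246's pulse half VERBATIM — exit `T'`, `r < T'`,
`T' - r ≤ 242/K⁹`, `T' - r ≤ 241 log K/K¹⁰`, `c > 0` on `[r, T']`, `b(T') = -θ₁ε`,
`abs (θ₁ - θ) ≤ 242 log K/K¹⁰`, `(ρ²/K⁹)e^{-485K} ≤ c(T') ≤ 2ρ²/K¹⁰`, the misfire pin, the output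
brackets, the transfer bound — AND, with `Λ = log(ρ²/K⁹) - log c(T')`: `log(K/2) ≤ Λ ≤
(723/2) log K` and THE DEBIT `θ² ≤ θ₁² + 2(1 - ã(r)²)Λ/K¹⁰ + (3 + 10⁻⁶)(ã(T') - ã(r))/K +
10⁻⁶/K¹⁰` (§260's functional on `[r, T']` with part 53 §158's radius; part 56 §170's upper law
with Duhamel weight `e^{(3/2)K¹⁰(T' - r)} ≤ K^{361.5}`, whence `μ(B(T') - B(r)) ≥ -Λ -
484/K¹⁰`; part 56 §169 for the `Λ` ceiling).
[derived: part 84 §246, part 56 §169–§170, part 53 §158, this file §260] -/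
theorem knob_pulse_debit
    (hX : ∀ t, HasDerivAt X (RotorKnob.rotorCircuit K (K ^ 10) ε ρ (X t)) t)
    (h0 : X 0 = delayInit) (hC : ∀ t, HasDerivAt C (X t 2) t) (hK : 16 ≤ K)
    (hε : 0 < ε) (hεK : ε ^ 2 ≤ 1 / (6 * K ^ 20)) (hρ : 0 < ρ)
    (hlo : 200 * ε / K ^ 20 ≤ ρ ^ 2) (hhi : K ^ 10 * ρ ^ 2 ≤ 2 * ε) (k : ℕ)
    (hk : ε = k * K ^ 10 * ρ ^ 2) {r θ : ℝ} (hr : 0 ≤ r) (hθ1 : 5 / 4 ≤ θ)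
    (hθ2 : θ ≤ 29 / 20) (hbr : X r 1 = θ * ε) (hcr : X r 2 = ρ ^ 2 / K ^ 9)
    (hPr : X r 3 ^ 2 + X r 4 ^ 2
      + 3 * (k * π / ((25 / 16 - 1 / 10 ^ 6) * K ^ 10 - 1) + 1 / K ^ 19
        + 310 * log K / K ^ 9) / 10 + 6 / K ^ 9 ≤ 1 / 50) :
    ∃ T' θ₁ : ℝ,
      (r < T' ∧ T' - r ≤ 242 / K ^ 9 ∧ T' - r ≤ 241 * log K / K ^ 10 ∧
      (∀ t ∈ Icc r T', 0 < X t 2) ∧ X T' 1 = -(θ₁ * ε) ∧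
      θ - 242 * log K / K ^ 10 ≤ θ₁ ∧ θ₁ ≤ θ + 242 * log K / K ^ 10 ∧
      ρ ^ 2 / K ^ 9 * exp (-(485 * K)) ≤ X T' 2 ∧ X T' 2 ≤ 2 * ρ ^ 2 / K ^ 10 ∧
      |(C T' - C r) / ρ ^ 2 - k * π|
        ≤ k * π / ((25 / 16 - 1 / 10 ^ 6) * K ^ 10 - 1) + 1 / K ^ 19 ∧
      0 ≤ X T' 4 ∧ X T' 4 ≤ X r 4 + K * (241 * log K / K ^ 10) ∧
      X r 4 + 1 / K ^ 9 ≤ X T' 4 ∧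
      X T' 4 ≤ X r 4 + (7 / 2 + k ^ 2 / 3 + (2 * log k + 520 * log K) * X r 3 ^ 2) / K ^ 9 ∧
      |X T' 3| ≤ |X r 3| + (5 * k + (k / 2 + 4) * (K * X T' 4)) / K ^ 10) ∧
      (log (K / 2) ≤ log (ρ ^ 2 / K ^ 9) - log (X T' 2) ∧
      log (ρ ^ 2 / K ^ 9) - log (X T' 2) ≤ 723 / 2 * log K ∧
      θ ^ 2 ≤ θ₁ ^ 2 + 2 * (1 - X r 4 ^ 2) * (log (ρ ^ 2 / K ^ 9) - log (X T' 2)) / K ^ 10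
        + (3 + 1 / 10 ^ 6) * (X T' 4 - X r 4) / K + 1 / (10 ^ 6 * K ^ 10)) := by
  have hK0 : (0 : ℝ) < K := by linarith
  have hKne : K ≠ 0 := hK0.ne'
  have hε0 : ε ≠ 0 := hε.ne'
  have hK9 : (0 : ℝ) < K ^ 9 := by positivity
  have hK10 : (0 : ℝ) < K ^ 10 := by positivity
  obtain ⟨-, hρε, -⟩ := pulse_clock_fine_numerics hK hε hρ hhi
  obtain ⟨hn1, hn2, hn3, hn4⟩ := pulse_debit_numerics hK hεK
  -- (0) numerics at `r`: `R²(r) ≤ (841/400)ε² + ε²/K¹⁸ ≤ 4ε²`, `2ρ²/K¹⁰ ≤ ρ²/K⁹`, the residual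
  have h9 : (0 : ℝ) < ρ ^ 2 / K ^ 9 := by positivity
  have hc2 : (ρ ^ 2 / K ^ 9) ^ 2 ≤ ε ^ 2 / K ^ 18 := by
    rw [div_pow, show (K ^ 9) ^ 2 = K ^ 18 by ring]
    exact div_le_div_of_nonneg_right (pow_le_pow_left₀ (sq_nonneg ρ) hρε 2) (by positivity)
  have h18 : ε ^ 2 / K ^ 18 ≤ ε ^ 2 / 10 ^ 6 := by
    have h := pow_le_pow_left₀ (by norm_num : (0 : ℝ) ≤ 16) hK 18
    exact div_le_div_of_nonneg_left (sq_nonneg ε) (by positivity) (by norm_num at h ⊢; linarith)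
  have hRr2 : X r 1 ^ 2 + X r 2 ^ 2 ≤ 841 / 400 * ε ^ 2 + ε ^ 2 / K ^ 18 := by
    rw [hbr, hcr]
    have hθsq : θ ^ 2 ≤ 841 / 400 := by
      nlinarith [mul_le_mul hθ2 hθ2 (by linarith) (by norm_num : (0 : ℝ) ≤ 29 / 20)]
    linarith [mul_le_mul_of_nonneg_right hθsq (sq_nonneg ε), hc2]
  have hRr : X r 1 ^ 2 + X r 2 ^ 2 ≤ 4 * ε ^ 2 := by linarith [hRr2, h18, sq_nonneg ε]
  have h2c : (2 : ℝ) * ρ ^ 2 / K ^ 10 ≤ ρ ^ 2 / K ^ 9 := by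
    rw [div_le_div_iff₀ hK10 hK9]
    linarith [mul_nonneg (mul_nonneg (sq_nonneg ρ) hK9.le) (by linarith : (0 : ℝ) ≤ K - 2)]
  have hres : 0 ≤ 1 / (10 ^ 6 * K ^ 10) - (1 - X r 4 ^ 2) * (968 / K ^ 20)
      - 27 / 4 * ε ^ 2 * (241 * log K / K ^ 10) := by
    linarith [hn2, mul_nonneg (sq_nonneg (X r 4)) (by positivity : (0 : ℝ) ≤ 968 / K ^ 20)]
  -- (1) part 84's pulse half
  obtain ⟨T', θ₁, hrT, hτ, hτf, hcpos, hbT, hθ₁lo, hθ₁hi, hfl, hcT, hpin, he0, hecr, hgain,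
      hceil, hdT⟩ :=
    knob_pulse_half_clock hX h0 hC hK hε hεK hρ hlo hhi k hk hr hθ1 hθ2 hbr hcr hPr
  refine ⟨T', θ₁, ⟨hrT, hτ, hτf, hcpos, hbT, hθ₁lo, hθ₁hi, hfl, hcT, hpin, he0, hecr, hgain,
    hceil, hdT⟩, ?_⟩
  clear hpin hceil hdT hecr hfl hθ₁lo hθ₁hi hPr hC hlo he0
  have hτ0 : 0 ≤ T' - r := by linarith only [hrT]
  have hcr0 : 0 < X r 2 := by rw [hcr]; positivity
  have hcT0 : 0 < X T' 2 := hcpos T' (right_mem_Icc.2 hrT.le)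
  have hcT2 : X T' 2 ^ 2 ≤ (ρ ^ 2 / K ^ 9) ^ 2 := pow_le_pow_left₀ hcT0.le (hcT.trans h2c) 2
  -- (2) the radius on the pulse: `R² ≤ 9ε²/4`, hence `b ≥ -3ε/2`
  have hkept := knob_radius_kept_free hX h0 hK10.le hε hρε hK hr hτ hRr
  have hR : ∀ t ∈ Icc r T', X t 1 ^ 2 + X t 2 ^ 2 ≤ 9 / 4 * ε ^ 2 := by
    intro t ht
    linarith only [hRr2, h18, (abs_le.1 (hkept t ht)).2, sq_nonneg ε]
  have hblo : ∀ t ∈ Icc r T', -(3 / 2 * ε) ≤ X t 1 := by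
    intro t ht
    have h1 : X t 1 ^ 2 ≤ (3 / 2 * ε) ^ 2 := by linarith only [hR t ht, sq_nonneg (X t 2)]
    have h2 := sq_le_sq.1 h1
    rw [abs_of_nonneg (by positivity : (0 : ℝ) ≤ 3 / 2 * ε)] at h2
    exact (abs_le.1 h2).1
  -- (3) a clock action; the action spent on the pulse is at least `-(3ε/2)(t - r)`
  have hXf := hX
  rw [RotorKnob.rotorCircuit_eq_fiveGate] at hXf
  obtain ⟨B, hB⟩ := exists_clock_action hXf
  have hBlo : ∀ t ∈ Icc r T', -(3 / 2 * ε * (t - r)) ≤ B t - B r := fun t ht =>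
    action_lower hB hblo ht
  -- (4) the functional on `[r, T']`
  have hfun := knob_pulse_debit_functional hX h0 hε.le hK0 hB hr hrT.le hR fun t ht =>
    (hcpos t ht).le
  -- (5) part 56's upper law with Duhamel weight `E = e^{(3/2)K¹⁰(T' - r)}`
  have hE : ∀ τ ∈ Icc r T', exp (-(ε⁻¹ * K ^ 10 * (B τ - B r)))
      ≤ exp (3 / 2 * K ^ 10 * (T' - r)) := by
    intro τ hτ'
    rw [Real.exp_le_exp]
    have h2 := mul_le_mul_of_nonneg_left (hBlo τ hτ') (by positivity : (0 : ℝ) ≤ ε⁻¹ * K ^ 10)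
    have h3 : ε⁻¹ * K ^ 10 * (3 / 2 * ε * (τ - r)) = 3 / 2 * K ^ 10 * (τ - r) := by
      field_simp
    have h4 : 3 / 2 * K ^ 10 * (τ - r) ≤ 3 / 2 * K ^ 10 * (T' - r) :=
      mul_le_mul_of_nonneg_left (by linarith only [hτ'.2]) (by positivity)
    linarith only [h2, h3, h4]
  have hdebt := trigger_debt hXf h0 (by positivity) hB hE (right_mem_Icc.2 hrT.le)
  have hKτ : K ^ 10 * (T' - r) ≤ 241 * log K := by
    have := mul_le_mul_of_nonneg_left hτf hK10.le
    rwa [mul_div_cancel₀ _ hK10.ne'] at this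
  have hexp : exp (-K ^ 10) * exp (3 / 2 * K ^ 10 * (T' - r)) ≤ 2 / K ^ 10 := by
    rw [← Real.exp_add]
    have h3 : exp (-K ^ 10 + 3 / 2 * K ^ 10 * (T' - r)) ≤ exp (-(K ^ 10 / 2)) :=
      Real.exp_le_exp.2 (by linarith only [hn3, hKτ])
    have h4 : exp (-(K ^ 10 / 2)) ≤ 1 / (1 + K ^ 10 / 2) := by
      rw [Real.exp_neg, one_div]
      exact inv_anti₀ (by positivity) (by linarith only [Real.add_one_le_exp (K ^ 10 / 2)])
    linarith only [h3, h4, hn4]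
  have hsum : X r 2 + ρ ^ 2 * exp (-K ^ 10) * exp (3 / 2 * K ^ 10 * (T' - r)) * (T' - r)
      ≤ ρ ^ 2 / K ^ 9 * (1 + 484 / K ^ 10) := by
    have h1 : ρ ^ 2 * exp (-K ^ 10) * exp (3 / 2 * K ^ 10 * (T' - r))
        ≤ ρ ^ 2 * (2 / K ^ 10) := by
      rw [mul_assoc]; exact mul_le_mul_of_nonneg_left hexp (sq_nonneg ρ)
    have h2 := mul_le_mul h1 hτ hτ0 (by positivity)
    have e : ρ ^ 2 / K ^ 9 * (1 + 484 / K ^ 10) = ρ ^ 2 / K ^ 9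
        + ρ ^ 2 * (2 / K ^ 10) * (242 / K ^ 9) := by
      field_simp; ring
    rw [e, hcr]; linarith only [h2]
  have hexpB : 0 < exp (ε⁻¹ * K ^ 10 * (B T' - B r)) := Real.exp_pos _
  have hcT1 : X T' 2
      ≤ ρ ^ 2 / K ^ 9 * (1 + 484 / K ^ 10) * exp (ε⁻¹ * K ^ 10 * (B T' - B r)) :=
    hdebt.trans (mul_le_mul_of_nonneg_right hsum hexpB.le)
  have h484 : (0 : ℝ) < 1 + 484 / K ^ 10 := by positivity
  have hlogT : log (X T' 2) ≤ log (ρ ^ 2 / K ^ 9) + 484 / K ^ 10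
      + ε⁻¹ * K ^ 10 * (B T' - B r) := by
    have h1 := Real.log_le_log hcT0 hcT1
    rw [Real.log_mul (by positivity) hexpB.ne', Real.log_mul h9.ne' h484.ne', Real.log_exp]
      at h1
    have h2 : log (1 + 484 / K ^ 10) ≤ 484 / K ^ 10 := by
      have := Real.log_le_sub_one_of_pos h484; linarith only [this]
    linarith only [h1, h2]
  -- hence `B(T') - B(r) ≥ (ε/K¹⁰)(log c(T') - log(ρ²/K⁹) - 484/K¹⁰)`
  have hΔB : ε / K ^ 10 * (log (X T' 2) - log (ρ ^ 2 / K ^ 9) - 484 / K ^ 10)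
      ≤ B T' - B r := by
    have h1 : log (X T' 2) - log (ρ ^ 2 / K ^ 9) - 484 / K ^ 10
        ≤ ε⁻¹ * K ^ 10 * (B T' - B r) := by linarith only [hlogT]
    have h2 := mul_le_mul_of_nonneg_left h1 (by positivity : (0 : ℝ) ≤ ε / K ^ 10)
    have e : ε / K ^ 10 * (ε⁻¹ * K ^ 10 * (B T' - B r)) = B T' - B r := by field_simp
    rwa [e] at h2
  -- (6) the `Λ` brackets
  have hΛlo : log (K / 2) ≤ log (ρ ^ 2 / K ^ 9) - log (X T' 2) := by
    have h1 := Real.log_le_log hcT0 hcT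
    have e : (2 : ℝ) * ρ ^ 2 / K ^ 10 = ρ ^ 2 / K ^ 9 / (K / 2) := by field_simp
    rw [e, Real.log_div h9.ne' (by positivity)] at h1
    linarith only [h1]
  have hΛhi : log (ρ ^ 2 / K ^ 9) - log (X T' 2) ≤ 723 / 2 * log K := by
    have hmem := knob_trigger_memory hX h0 hε hK10.le hB hr hrT.le hcr0
    rw [hcr] at hmem
    have h1 := Real.log_le_log (by positivity) hmem
    rw [Real.log_mul h9.ne' hexpB.ne', Real.log_exp] at h1
    have h2 := mul_le_mul_of_nonneg_left (hBlo T' (right_mem_Icc.2 hrT.le))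
      (by positivity : (0 : ℝ) ≤ ε⁻¹ * K ^ 10)
    have e : ε⁻¹ * K ^ 10 * (3 / 2 * ε * (T' - r)) = 3 / 2 * K ^ 10 * (T' - r) := by
      field_simp
    linarith only [h1, h2, e, hKτ]
  refine ⟨hΛlo, hΛhi, ?_⟩
  -- (7) assemble: `R²(T') = θ₁²ε² + c(T')²`, `R²(r) = θ²ε² + (ρ²/K⁹)²`, `c(T')² ≤ (ρ²/K⁹)²`
  have her0 : 0 ≤ X r 4 := RotorKnob.e_nonneg hX h0 hK0.le hr
  have her1 : X r 4 ≤ 1 := (abs_le.1 (RotorKnob.traj_abs_le_one hX h0 r 4)).2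
  have heT1 : X T' 4 ≤ 1 := (abs_le.1 (RotorKnob.traj_abs_le_one hX h0 T' 4)).2
  have hg0 : 0 ≤ X T' 4 - X r 4 :=
    sub_nonneg.2 ((le_add_of_nonneg_right (one_div_nonneg.2 hK9.le)).trans hgain)
  have hg1 : X T' 4 - X r 4 ≤ 1 := by linarith only [heT1, her0]
  have e1 : X r 1 ^ 2 = θ ^ 2 * ε ^ 2 := by rw [hbr]; ring
  have e2 : X T' 1 ^ 2 = θ₁ ^ 2 * ε ^ 2 := by rw [hbT]; ring
  have e3 : X r 2 ^ 2 = (ρ ^ 2 / K ^ 9) ^ 2 := by rw [hcr]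
  have hW0 : 0 ≤ 1 - X r 4 ^ 2 := by
    linarith only [mul_nonneg (sub_nonneg.2 her1) (by linarith only [her0] : (0 : ℝ) ≤ 1 + X r 4)]
  have hact := mul_le_mul_of_nonneg_left hΔB (mul_nonneg (by positivity) hW0 : 0 ≤ 2 * ε * _)
  -- the κ-term: `3ε²κ(T' - r) ≤ ε²(10⁻⁶ g/K) + ε²(27/4)ε²(241 log K/K¹⁰)`
  have hκ : 3 * ε ^ 2 * (2 * X r 4 * (X T' 4 - X r 4) + (X T' 4 - X r 4) ^ 2 + 9 / 4 * ε ^ 2)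
      * (T' - r) ≤ ε ^ 2 * ((X T' 4 - X r 4) * (1 / (10 ^ 6 * K)))
        + ε ^ 2 * (27 / 4 * ε ^ 2 * (241 * log K / K ^ 10)) := by
    have h1 : 2 * X r 4 * (X T' 4 - X r 4) + (X T' 4 - X r 4) ^ 2 ≤ 3 * (X T' 4 - X r 4) := by
      linarith only [mul_nonneg (sub_nonneg.2 her1) hg0, mul_nonneg hg0 (sub_nonneg.2 hg1)]
    have hpos : 0 ≤ 3 * ε ^ 2 * (3 * (X T' 4 - X r 4) + 9 / 4 * ε ^ 2) :=
      mul_nonneg (by positivity) (by linarith only [hg0, sq_nonneg ε])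
    have h2 : 3 * ε ^ 2 * (2 * X r 4 * (X T' 4 - X r 4) + (X T' 4 - X r 4) ^ 2
        + 9 / 4 * ε ^ 2) * (T' - r) ≤ 3 * ε ^ 2 * (3 * (X T' 4 - X r 4) + 9 / 4 * ε ^ 2)
          * (241 * log K / K ^ 10) :=
      (mul_le_mul_of_nonneg_right (mul_le_mul_of_nonneg_left (by linarith only [h1])
        (by positivity)) hτ0).trans (mul_le_mul_of_nonneg_left hτf hpos)
    have h3 := mul_le_mul_of_nonneg_left (mul_le_mul_of_nonneg_left hn1 hg0) (sq_nonneg ε)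
    linarith only [h2, h3]
  -- `θ²ε² ≤ S`
  have hS : θ ^ 2 * ε ^ 2 ≤ θ₁ ^ 2 * ε ^ 2 + 2 * ε * (1 - X r 4 ^ 2)
      * (ε / K ^ 10 * (log (ρ ^ 2 / K ^ 9) - log (X T' 2) + 484 / K ^ 10))
      + 3 * ε ^ 2 / K * (X T' 4 - X r 4) + ε ^ 2 * ((X T' 4 - X r 4) * (1 / (10 ^ 6 * K)))
      + ε ^ 2 * (27 / 4 * ε ^ 2 * (241 * log K / K ^ 10)) := by
    linarith only [hfun, hcT2, hact, hκ, e1, e2, e3]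
  have e : (θ₁ ^ 2 + 2 * (1 - X r 4 ^ 2) * (log (ρ ^ 2 / K ^ 9) - log (X T' 2)) / K ^ 10
      + (3 + 1 / 10 ^ 6) * (X T' 4 - X r 4) / K + 1 / (10 ^ 6 * K ^ 10)) * ε ^ 2
      - (θ₁ ^ 2 * ε ^ 2 + 2 * ε * (1 - X r 4 ^ 2)
        * (ε / K ^ 10 * (log (ρ ^ 2 / K ^ 9) - log (X T' 2) + 484 / K ^ 10))
        + 3 * ε ^ 2 / K * (X T' 4 - X r 4) + ε ^ 2 * ((X T' 4 - X r 4) * (1 / (10 ^ 6 * K)))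
        + ε ^ 2 * (27 / 4 * ε ^ 2 * (241 * log K / K ^ 10)))
      = ε ^ 2 * (1 / (10 ^ 6 * K ^ 10) - (1 - X r 4 ^ 2) * (968 / K ^ 20)
        - 27 / 4 * ε ^ 2 * (241 * log K / K ^ 10)) := by
    field_simp; ring
  have key : θ ^ 2 * ε ^ 2 ≤ (θ₁ ^ 2 + 2 * (1 - X r 4 ^ 2) * (log (ρ ^ 2 / K ^ 9) - log (X T' 2))
      / K ^ 10 + (3 + 1 / 10 ^ 6) * (X T' 4 - X r 4) / K + 1 / (10 ^ 6 * K ^ 10)) * ε ^ 2 := by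
    linarith only [hS, e, mul_nonneg (sq_nonneg ε) hres]
  exact le_of_mul_le_mul_right key (by positivity)

end Summit.NavierStokesRegularity.FluidComputer.GateBudget
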